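import Mathlib
import Summits.NavierStokesRegularity.NavierStokesRegularity.Theses.LoopPeriodRatchet
import HarnessLib

/-!
# `LoopPeriodRatchet.OpenLoopLiouvilleGlue` — glue of the gen-1 split of `OpenLoopLiouville`
(item stmt-NavierStokesRegularity-22882; pure logic)

**Statement.** `NoPlanarExtremum → PlanarExtremumLiouville → OpenLoopLiouville`.

PROOF. Given an e₃-poloidal Type-I Oseen-mild ancient profile in the Frobenius class, non-flat on
some slice and without closed vortex lines carrying vorticity, child 1 (`NoPlanarExtremum`) turns
loop-freeness into the absence of strict planar local extrema of the plane stream function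
`ψ = v₃ − ∂₃Φ` at every slice and for every planar potential `Φ`; child 2
(`PlanarExtremumLiouville`) says such a profile is not backward singular at the apex. The binder
orders of the three route declarations match literally.

HONEST FRAMING: pure logic between the route's own statements (children ⟹ parent); both children
stay hypotheses (child 2 is an open crux); nothing here bears on Navier–Stokes regularity itself.
-/

noncomputable section

set_option linter.dupNamespace false

namespace Summit.NavierStokesRegularity.NavierStokesRegularity.Theorems

open Summit.NavierStokesRegularity.NavierStokesRegularity.Theses.LoopPeriodRatchet in
/-- **Item stmt-NavierStokesRegularity-22882** (`LoopPeriodRatchet.OpenLoopLiouvilleGlue`): the two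
gen-1 children `NoPlanarExtremum` (poloidal + loop-free ⇒ no strict planar extremum of the plane
stream function) and `PlanarExtremumLiouville` (no planar extremum ⇒ not backward singular) imply
the parent `OpenLoopLiouville`. Pure logic. [this file] -/
theorem openLoopLiouvilleGlue_proof :
    Summit.NavierStokesRegularity.NavierStokesRegularity.Theses.LoopPeriodRatchet.OpenLoopLiouvilleGlue := by
  unfold Summit.NavierStokesRegularity.NavierStokesRegularity.Theses.LoopPeriodRatchet.OpenLoopLiouvilleGlue
  intro h₅ h₆ C v hr hc hm hd hpol hfro hnf hloop
  exact h₆ C v hr hc hm hd hpol hfro hnf (h₅ C v hr hc hm hd hpol hloop)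

end Summit.NavierStokesRegularity.NavierStokesRegularity.Theorems

end
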